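import Literature.Topology.FourManifolds.SmallSetComplement
import Mathlib.AlgebraicTopology.FundamentalGroupoid.SimplyConnected
import Mathlib.Analysis.Convex.Contractible
import Mathlib.Topology.Subpath
import Mathlib.Topology.MetricSpace.Thickening
import HarnessLib

/-!
# Loops in the complement of a closed set of codimension `≥ 3` in a convex set contract

Topic `Literature/Topology/FourManifolds` (fact seat
`provefact-Literature.Topology.FourManifolds.Cobordism.Milnor1965_simplyConnected_plusLevelTwo`;
first rung — the local statement — of the general-position leaf
`Literature.Topology.FourManifolds.isSimplyConnected_diff_of_subset_iUnion_image` of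
`HCobordismLevelSimplyConnected.lean`).  Everything here is **proved**; it is the `π₁`
companion of the tree's `Literature.Topology.FourManifolds.SmallSet.joinedIn_diff`
(`SmallSetComplement.lean`, two-segment paths in general position), by the same
Hausdorff-dimension count.

**The statement** (`Literature.Topology.FourManifolds.SmallSet.isSimplyConnected_diff`).  Let
`E` be a finite-dimensional real normed space, `T ⊆ E` a set covered by countably many `C¹`
images `hᵢ(Wᵢ)` of open subsets `Wᵢ` of a parameter space `P` with `dim P + 3 ≤ dim E`, and
`C ⊆ E` a nonempty open convex set with `C ∖ T` open (i.e. `T ∩ C` relatively closed).  Then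
`C ∖ T` is simply connected.  This is the classical general-position fact that a `2`-disc in
`ℝⁿ` can be pushed off a closed set of dimension `≤ n - 3` (the remark *"this uses `λ ≥ 2`,
`n - λ ≥ 3`"* of Milnor, *Lectures on the h-cobordism theorem* (1965), Remark 1 after
Thm. 6.4, p. 70; Hurewicz–Wallman, *Dimension Theory* (1941), Ch. IV §5 for the
codimension-`2` separation statement).

**Proof.**  Path connectedness is `SmallSet.joinedIn_diff`.  Given a loop `p` in `C ∖ T`:
(1) `p` has an `ε`-neighbourhood inside the open set `C ∖ T`, and is uniformly continuous, so
for a fine subdivision `0 = t₀ < ⋯ < t_N = 1` each arc `p|[t_k, t_{k+1}]` is homotopic, by the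
straight-line homotopy inside that neighbourhood, to the segment `[p t_k, p t_{k+1}]`
(`SmallSet.linearHomotopy`, chords as `AffineMap.lineMap`); with Mathlib's `Path.concat` / `Path.Homotopy.concatSubpath`
the loop is homotopic in `C ∖ T` to the inscribed polygon `L`.  (2) The apexes `z` from
which some segment `[z, y]`, `y ∈ L`, meets `T` form the union of the *cones over `T` from
the sides of `L`* (`SmallSet.coneOverSeg`), `C¹` images of `Wᵢ × ℝ²`, of Hausdorff dimension
`≤ dim P + 2 < dim E` (`SmallSet.dimH_coneOverSeg_le`); so some `z ∈ C` sees all of `L`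
inside `C ∖ T`.  (3) The set of points of `C ∖ T` visible from `z` (`SmallSet.visibleSet`) is
star-shaped about `z`, hence simply connected (Mathlib's `StarConvex.contractibleSpace`),
lies in `C ∖ T` and contains `L`; so `L`, and with it `p`, is null-homotopic in `C ∖ T`.

## References

* W. Hurewicz, H. Wallman, *Dimension Theory*, Princeton (1941), Ch. IV §5. [HurewiczWallman1941]
* J. Milnor, *Lectures on the h-cobordism theorem*, Princeton (1965), Remark 1 after Thm. 6.4
  (p. 70; PDF p. 38 of the held copy). [MilnorHCobordism1965]
-/

open scoped Topology ENNReal unitInterval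
open Set Function Filter Metric Module

noncomputable section

namespace Literature.Topology.FourManifolds

namespace SmallSet

variable {E : Type*} [NormedAddCommGroup E] [NormedSpace ℝ E]
  {P : Type*} [NormedAddCommGroup P] [NormedSpace ℝ P] [FiniteDimensional ℝ P]

/-! ### Cones over `T` from a segment -/

/-- Every point of `[a, b]` is an `AffineMap.lineMap a b l`, `l ∈ [0, 1]`. [folklore] -/
theorem exists_lineMap_of_mem_segment {a b y : E} (hy : y ∈ segment ℝ a b) :
    ∃ l ∈ Icc (0 : ℝ) 1, AffineMap.lineMap a b l = y := by
  rw [segment_eq_image_lineMap] at hy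
  obtain ⟨l, hl, rfl⟩ := hy
  exact ⟨l, hl, rfl⟩

/-- The **cone over `T` from the segment `[a, b]`**: the points `y + s (τ - y)` with
`y = AffineMap.lineMap a b l ∈ [a, b]`, `τ ∈ T`, `s ≥ 1` — the apexes `z` such that some
segment `[z, y]`, `y ∈ [a, b]`, meets `T` beyond `y`. [folklore] -/
def coneOverSeg (a b : E) (T : Set E) : Set E :=
  (fun q : E × ℝ × ℝ =>
      AffineMap.lineMap a b q.2.1 + q.2.2 • (q.1 - AffineMap.lineMap a b q.2.1)) ''
    (T ×ˢ (Icc (0 : ℝ) 1 ×ˢ Ici (1 : ℝ)))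

/-- If `y ∈ [a, b]`, `y ∉ T`, and the segment `[y, z]` meets `T`, then `z` lies in the cone over
`T` from `[a, b]`. [folklore] -/
theorem mem_coneOverSeg_of_mem_segment {a b y z τ : E} {T : Set E} (hy : y ∈ segment ℝ a b)
    (hτ : τ ∈ segment ℝ y z) (hτT : τ ∈ T) (hyT : y ∉ T) : z ∈ coneOverSeg a b T := by
  obtain ⟨l, hl, rfl⟩ := exists_lineMap_of_mem_segment hy
  rw [segment_eq_image'] at hτ
  obtain ⟨θ, ⟨hθ0, hθ1⟩, rfl⟩ := hτ
  have hθ : θ ≠ 0 := by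
    rintro rfl
    simp only [zero_smul, add_zero] at hτT
    exact hyT hτT
  have hθpos : 0 < θ := lt_of_le_of_ne hθ0 (Ne.symm hθ)
  refine ⟨(AffineMap.lineMap a b l + θ • (z - AffineMap.lineMap a b l), l, θ⁻¹),
    ⟨hτT, hl, ?_⟩, ?_⟩
  · exact (one_le_inv₀ hθpos).2 hθ1
  · simp only [add_sub_cancel_left, smul_smul, inv_mul_cancel₀ hθ, one_smul, add_sub_cancel]

/-- The cone over a countable union of `C¹` images of open subsets of `P` from a segment has
Hausdorff dimension at most `dim P + 2`: it is covered by the `C¹` images of `Wᵢ × ℝ × ℝ` under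
`(w, l, s) ↦ y_l + s (hᵢ w - y_l)`. [folklore] -/
theorem dimH_coneOverSeg_le {ι : Type*} [Countable ι] {T : Set E} (h : ι → P → E)
    (W : ι → Set P) (hW : ∀ i, IsOpen (W i)) (hh : ∀ i, ContDiffOn ℝ 1 (h i) (W i))
    (hT : T ⊆ ⋃ i, h i '' W i) (a b : E) : dimH (coneOverSeg a b T) ≤ finrank ℝ P + 2 := by
  set F : ι → P × ℝ × ℝ → E := fun i q =>
    AffineMap.lineMap a b q.2.1 + q.2.2 • (h i q.1 - AffineMap.lineMap a b q.2.1) with hF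
  have hsub : coneOverSeg a b T ⊆ ⋃ i, F i '' (W i ×ˢ univ) := by
    rintro z ⟨⟨τ, l, s⟩, ⟨hτT, -, -⟩, rfl⟩
    obtain ⟨i, w, hw, rfl⟩ := mem_iUnion.1 (hT hτT) |>.imp fun i hi => mem_image _ _ _ |>.1 hi
    exact mem_iUnion.2 ⟨i, (w, l, s), ⟨hw, mem_univ _⟩, rfl⟩
  have hseg : ContDiff ℝ 1 fun q : P × ℝ × ℝ => AffineMap.lineMap a b q.2.1 := by
    have heq : (fun q : P × ℝ × ℝ => AffineMap.lineMap a b q.2.1) =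
        fun q => q.2.1 • (b - a) + a := by
      funext q; rw [AffineMap.lineMap_apply_module']
    rw [heq]
    exact ((contDiff_fst.comp contDiff_snd).smul contDiff_const).add contDiff_const
  have hFd : ∀ i, ContDiffOn ℝ 1 (F i) (W i ×ˢ univ) := fun i =>
    hseg.contDiffOn.add ((contDiffOn_snd.comp contDiffOn_snd fun q hq => mem_univ _).smul
      (((hh i).comp contDiffOn_fst fun q hq => hq.1).sub hseg.contDiffOn))
  have hrank : (finrank ℝ (P × ℝ × ℝ) : ℝ≥0∞) = finrank ℝ P + 2 := by
    rw [Module.finrank_prod, Module.finrank_prod, Module.finrank_self]; push_cast; ring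
  calc dimH (coneOverSeg a b T) ≤ dimH (⋃ i, F i '' (W i ×ˢ univ)) := dimH_mono hsub
    _ = ⨆ i, dimH (F i '' (W i ×ˢ univ)) := dimH_iUnion _
    _ ≤ finrank ℝ (P × ℝ × ℝ) :=
        iSup_le fun i => dimH_image_le_finrank ((hW i).prod isOpen_univ) (hFd i)
    _ = finrank ℝ P + 2 := hrank

/-! ### A generic apex sees a whole polygon -/

/-- **Generic apexes.**  If `dim P + 3 ≤ dim E`, then for finitely many segments `[aₖ, bₖ]` and
a nonempty open set `C` there is a point `z ∈ C`, not in `T`, and outside all the cones over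
`T` from the `[aₖ, bₖ]` (their union with `T` has Hausdorff dimension `< dim E`, hence dense
complement). [folklore] -/
theorem exists_apex [FiniteDimensional ℝ E] (hdim : finrank ℝ P + 3 ≤ finrank ℝ E)
    {ι : Type*} [Countable ι] {T : Set E} (h : ι → P → E) (W : ι → Set P)
    (hW : ∀ i, IsOpen (W i)) (hh : ∀ i, ContDiffOn ℝ 1 (h i) (W i)) (hT : T ⊆ ⋃ i, h i '' W i)
    {N : ℕ} (a b : Fin N → E) {C : Set E} (hCo : IsOpen C) (hCne : C.Nonempty) :
    ∃ z ∈ C, z ∉ T ∧ ∀ k, z ∉ coneOverSeg (a k) (b k) T := by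
  set B : Set E := T ∪ ⋃ k, coneOverSeg (a k) (b k) T with hB
  have hBdim : dimH B < finrank ℝ E := by
    have hlt : ((finrank ℝ P : ℝ≥0∞) + 2) < finrank ℝ E := by
      have : (finrank ℝ P + 2 : ℕ) < finrank ℝ E := by omega
      exact_mod_cast this
    rw [hB, dimH_union, dimH_iUnion]
    refine max_lt ?_ (lt_of_le_of_lt (iSup_le fun k => dimH_coneOverSeg_le h W hW hh hT _ _) hlt)
    refine lt_of_le_of_lt (dimH_le_finrank_of_subset_iUnion h W hW hh hT) (lt_of_le_of_lt ?_ hlt)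
    exact_mod_cast Nat.le_add_right _ _
  obtain ⟨z, hzB, hzC⟩ := (dense_compl_of_dimH_lt_finrank hBdim).exists_mem_open hCo hCne
  simp only [hB, mem_compl_iff, mem_union, mem_iUnion, not_or, not_exists] at hzB
  exact ⟨z, hzC, hzB.1, hzB.2⟩

/-! ### The points visible from an apex -/

/-- The points of `A` **visible from `z` inside `A`**: those `w ∈ A` with `[z, w] ⊆ A`. [folklore] -/
def visibleSet (z : E) (A : Set E) : Set E := {w | w ∈ A ∧ segment ℝ z w ⊆ A}

/-- The visible set lies in `A`. [folklore] -/
theorem visibleSet_subset (z : E) (A : Set E) : visibleSet z A ⊆ A := fun _ hw => hw.1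

/-- `z` is visible from itself when `z ∈ A`. [folklore] -/
theorem self_mem_visibleSet {z : E} {A : Set E} (hz : z ∈ A) : z ∈ visibleSet z A :=
  ⟨hz, by rw [segment_same]; exact singleton_subset_iff.2 hz⟩

/-- The visible set is star-shaped about the apex. [folklore] -/
theorem starConvex_visibleSet (z : E) (A : Set E) : StarConvex ℝ z (visibleSet z A) := by
  intro w hw c d hc hd hcd
  have hv : c • z + d • w ∈ segment ℝ z w := ⟨c, d, hc, hd, hcd, rfl⟩
  have hsub : segment ℝ z (c • z + d • w) ⊆ segment ℝ z w :=
    (convex_segment z w).segment_subset (left_mem_segment ℝ z w) hv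
  exact ⟨hw.2 hv, hsub.trans hw.2⟩

/-- A nonempty star-shaped set — in particular a visible set containing its apex — is simply
connected (it is contractible). [folklore] -/
theorem isSimplyConnected_visibleSet {z : E} {A : Set E} (hz : z ∈ A) :
    IsSimplyConnected (visibleSet z A) := by
  haveI := (starConvex_visibleSet z A).contractibleSpace ⟨z, self_mem_visibleSet hz⟩
  exact SimplyConnectedSpace.ofContractible _

/-- **From a generic apex the whole segment is visible.**  If `C` is convex, `z ∈ C ∖ T` lies
outside the cone over `T` from `[a, b]`, and `[a, b] ⊆ C ∖ T`, then every point of `[a, b]` is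
visible from `z` inside `C ∖ T`. [folklore] -/
theorem segment_subset_visibleSet {C T : Set E} (hC : Convex ℝ C) {z a b : E} (hzC : z ∈ C)
    (hz : z ∉ coneOverSeg a b T) (hab : segment ℝ a b ⊆ C \ T) :
    segment ℝ a b ⊆ visibleSet z (C \ T) := by
  intro y hy
  refine ⟨hab hy, fun v hv => ⟨hC.segment_subset hzC (hab hy).1 hv, fun hvT => hz ?_⟩⟩
  rw [segment_symm] at hv
  exact mem_coneOverSeg_of_mem_segment hy hv hvT (hab hy).2

/-! ### Straight-line homotopies and casts of paths inside a subset -/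

section Paths

variable {A : Set E}

/-- **The straight-line homotopy between two paths of a subset of `E`, when it stays in the
subset.**  For paths `γ₀`, `γ₁` with the same end points in `A ⊆ E` such that every point
`(1 - s) γ₀(u) + s γ₁(u)` lies in `A`, the straight-line homotopy is a path homotopy in `A`.
[folklore] -/
def linearHomotopy {a b : A} (γ₀ γ₁ : Path a b)
    (hmem : ∀ s u : I, (1 - (s : ℝ)) • (γ₀ u : E) + (s : ℝ) • (γ₁ u : E) ∈ A) :
    Path.Homotopy γ₀ γ₁ where
  toFun q := ⟨(1 - (q.1 : ℝ)) • (γ₀ q.2 : E) + (q.1 : ℝ) • (γ₁ q.2 : E), hmem q.1 q.2⟩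
  continuous_toFun := by
    refine Continuous.subtype_mk ?_ _
    have h₀ : Continuous fun q : I × I => (γ₀ q.2 : E) :=
      continuous_subtype_val.comp (γ₀.continuous.comp continuous_snd)
    have h₁ : Continuous fun q : I × I => (γ₁ q.2 : E) :=
      continuous_subtype_val.comp (γ₁.continuous.comp continuous_snd)
    have hs : Continuous fun q : I × I => ((q.1 : I) : ℝ) :=
      continuous_subtype_val.comp continuous_fst
    exact ((continuous_const.sub hs).smul h₀).add (hs.smul h₁)
  map_zero_left u := by
    ext
    show (1 - ((0 : I) : ℝ)) • (γ₀ u : E) + ((0 : I) : ℝ) • (γ₁ u : E) = γ₀ u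
    simp
  map_one_left u := by
    ext
    show (1 - ((1 : I) : ℝ)) • (γ₀ u : E) + ((1 : I) : ℝ) • (γ₁ u : E) = γ₁ u
    simp
  prop' s u hu := by
    show (⟨(1 - (s : ℝ)) • (γ₀ u : E) + (s : ℝ) • (γ₁ u : E), hmem s u⟩ : A) = γ₀ u
    have hγ : (γ₁ u : E) = γ₀ u := by
      rcases hu with rfl | hu'
      · rw [γ₀.source, γ₁.source]
      · rw [Set.mem_singleton_iff] at hu'
        subst hu'
        rw [γ₀.target, γ₁.target]
    ext
    show (1 - (s : ℝ)) • (γ₀ u : E) + (s : ℝ) • (γ₁ u : E) = γ₀ u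
    rw [hγ, ← add_smul, sub_add_cancel, one_smul]

/-- The range of a concatenation of paths lies in any set containing the starting point and
all the pieces. [folklore] -/
theorem concat_mem {X : Type*} [TopologicalSpace X] {S : Set X} :
    ∀ {n : ℕ} (p : Fin (n + 1) → X) (F : (k : Fin n) → Path (p k.castSucc) (p k.succ)),
      p 0 ∈ S → (∀ k u, F k u ∈ S) → ∀ u, Path.concat p F u ∈ S
  | 0, p, F, h0, _, u => by
    rw [Path.concat_zero]
    exact h0
  | n + 1, p, F, h0, hF, u => by
    rw [Path.concat_succ]
    have hmem : (Path.concat (p ∘ Fin.castSucc) (fun k => F k.castSucc)).trans (F (Fin.last n)) u ∈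
        range ((Path.concat (p ∘ Fin.castSucc) (fun k => F k.castSucc)).trans (F (Fin.last n))) :=
      mem_range_self u
    rw [Path.trans_range] at hmem
    rcases hmem with ⟨v, hv⟩ | ⟨v, hv⟩
    · exact hv ▸ concat_mem (p ∘ Fin.castSucc) (fun k => F k.castSucc) h0 (fun k u => hF _ u) v
    · exact hv ▸ hF _ v

end Paths

/-! ### The theorem -/

/-- **Loops in the complement of a closed set of codimension `≥ 3` in a convex open set
contract.**  Let `T ⊆ E` be covered by countably many `C¹` images of open subsets of `P`,
`dim P + 3 ≤ dim E`, and let `C` be a nonempty open convex set with `C ∖ T` open.  Then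
`C ∖ T` is simply connected (path connected by `SmallSet.joinedIn_diff`; a loop is homotopic
in `C ∖ T` to an inscribed polygon, which is contracted inside the star-shaped set of points
visible from a generic apex — see the module docstring).  This is the general-position remark
*"this uses `λ ≥ 2`, `n - λ ≥ 3`"* of Milnor (1965), Remark 1 after Thm. 6.4, in the local
form. [folklore] -/
theorem isSimplyConnected_diff [FiniteDimensional ℝ E] (hdim : finrank ℝ P + 3 ≤ finrank ℝ E)
    {ι : Type*} [Countable ι] {T : Set E} (h : ι → P → E) (W : ι → Set P)
    (hW : ∀ i, IsOpen (W i)) (hh : ∀ i, ContDiffOn ℝ 1 (h i) (W i)) (hT : T ⊆ ⋃ i, h i '' W i)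
    {C : Set E} (hC : Convex ℝ C) (hCo : IsOpen C) (hCne : C.Nonempty) (hCT : IsOpen (C \ T)) :
    IsSimplyConnected (C \ T) := by
  have hdim2 : finrank ℝ P + 2 ≤ finrank ℝ E := by omega
  set A : Set E := C \ T with hA
  -- `C ∖ T` is nonempty and path connected
  obtain ⟨x₀, hx₀T, hx₀C⟩ := (dense_compl (by omega) h W hW hh hT).exists_mem_open hCo hCne
  have hpc : IsPathConnected A :=
    ⟨x₀, ⟨hx₀C, hx₀T⟩, fun y hy => joinedIn_diff hdim2 h W hW hh hT hC hCo ⟨hx₀C, hx₀T⟩ hy⟩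
  rw [IsSimplyConnected, simply_connected_iff_loops_nullhomotopic]
  haveI : PathConnectedSpace A := (isPathConnected_iff_pathConnectedSpace).1 hpc
  refine ⟨inferInstance, fun x p => ?_⟩
  ----------------------------------------------------------------------------------------------
  -- Step 1: room around the loop, and a fine subdivision
  ----------------------------------------------------------------------------------------------
  let pE : Path (x : E) (x : E) := p.map continuous_subtype_val
  have hpE : ∀ u, pE u = (p u : E) := fun u => rfl
  obtain ⟨ε, hε, hthick⟩ := (isCompact_range pE.continuous).exists_cthickening_subset_open hCT
    (by rintro _ ⟨u, rfl⟩; exact (p u).2)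
  have hroom : ∀ (w : E) (u : I), dist w (pE u) ≤ ε → w ∈ A := fun w u hwu =>
    hthick (Metric.mem_cthickening_of_dist_le w (pE u) ε _ (mem_range_self u) hwu)
  obtain ⟨δ, hδ, hunif⟩ := Metric.uniformContinuous_iff.1
    (CompactSpace.uniformContinuous_of_continuous pE.continuous) ε hε
  obtain ⟨N', hN'⟩ := exists_nat_one_div_lt hδ
  set N : ℕ := N' + 1 with hNdef
  have hNpos : (0 : ℝ) < N := by rw [hNdef]; positivity
  have hN1 : 1 / (N : ℝ) < δ := by rw [hNdef]; push_cast; exact hN'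
  -- the subdivision points `t k = k / N`
  let t : Fin (N + 1) → I := fun k => ⟨(k : ℝ) / N, by positivity, by
    rw [div_le_one hNpos]; exact_mod_cast Fin.is_le k⟩
  have ht : ∀ k : Fin (N + 1), ((t k : I) : ℝ) = (k : ℝ) / N := fun k => rfl
  have ht0 : ((t 0 : I) : ℝ) = 0 := by rw [ht]; simp
  have ht1 : ((t (Fin.last N) : I) : ℝ) = 1 := by
    rw [ht, Fin.val_last, div_self hNpos.ne']
  -- the vertices of the inscribed polygon
  let xv : Fin (N + 1) → E := fun k => pE (t k)
  -- the reparametrised parameter of the `k`-th arc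
  let conv : Fin N → I → I := fun k u => Icc.convexComb (t k.castSucc) (t k.succ) u
  have hconv : ∀ k u, ((conv k u : I) : ℝ) = (k : ℝ) / N + (u : ℝ) / N := by
    intro k u
    show (1 - (u : ℝ)) * ((t k.castSucc : I) : ℝ) + (u : ℝ) * ((t k.succ : I) : ℝ) = _
    rw [ht, ht, Fin.val_castSucc, Fin.val_succ]
    push_cast
    field_simp
    ring
  -- the arcs stay `ε`-close to both end vertices
  have hclose : ∀ (k : Fin N) (u : I),
      dist (xv k.castSucc) (pE (conv k u)) < ε ∧ dist (xv k.succ) (pE (conv k u)) < ε := by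
    intro k u
    have hu0 : (0 : ℝ) ≤ u := u.2.1
    have hu1 : (u : ℝ) ≤ 1 := u.2.2
    constructor
    · refine hunif ?_
      rw [Subtype.dist_eq, Real.dist_eq, ht, hconv, Fin.val_castSucc]
      have h1 : (k : ℝ) / N - ((k : ℝ) / N + (u : ℝ) / N) = -((u : ℝ) / N) := by ring
      rw [h1, abs_neg, abs_of_nonneg (by positivity)]
      exact lt_of_le_of_lt (div_le_div_of_nonneg_right hu1 hNpos.le) hN1
    · refine hunif ?_
      rw [Subtype.dist_eq, Real.dist_eq, ht, hconv, Fin.val_succ]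
      have h1 : ((k + 1 : ℕ) : ℝ) / N - ((k : ℝ) / N + (u : ℝ) / N) = (1 - (u : ℝ)) / N := by
        push_cast; ring
      rw [h1, abs_of_nonneg (by apply div_nonneg <;> linarith)]
      exact lt_of_le_of_lt (div_le_div_of_nonneg_right (by linarith) hNpos.le) hN1
  -- the sides of the polygon lie in the `ε`-balls about the arcs, hence in `A`
  have hball : ∀ (k : Fin N) (u : I),
      AffineMap.lineMap (xv k.castSucc) (xv k.succ) (u : ℝ) ∈ ball (pE (conv k u)) ε := fun k u =>
    (convex_ball _ ε).segment_subset (mem_ball.2 (hclose k u).1) (mem_ball.2 (hclose k u).2)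
      (lineMap_mem_segment ℝ _ _ ⟨u.2.1, u.2.2⟩)
  have hsegA : ∀ (k : Fin N) (u : I),
      AffineMap.lineMap (xv k.castSucc) (xv k.succ) (u : ℝ) ∈ A := fun k u =>
    hroom _ (conv k u) (mem_ball.1 (hball k u)).le
  have hmemA : ∀ (k : Fin N) (s u : I),
      (1 - (s : ℝ)) • pE (conv k u) +
        (s : ℝ) • AffineMap.lineMap (xv k.castSucc) (xv k.succ) (u : ℝ) ∈ A := by
    intro k s u
    refine hroom _ (conv k u) (mem_ball.1 ?_).le
    exact (convex_ball (pE (conv k u)) ε) (mem_ball_self hε) (hball k u) (by linarith [s.2.2])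
      s.2.1 (by ring)
  ----------------------------------------------------------------------------------------------
  -- Step 2: the loop is homotopic in `A` to the inscribed polygon
  ----------------------------------------------------------------------------------------------
  -- the sides, as paths of `A`
  let G : (k : Fin N) → Path ((⇑p ∘ t) k.castSucc) ((⇑p ∘ t) k.succ) := fun k =>
    { toFun := fun u => ⟨AffineMap.lineMap (xv k.castSucc) (xv k.succ) (u : ℝ), hsegA k u⟩
      continuous_toFun :=
        (AffineMap.lineMap_continuous.comp continuous_subtype_val).subtype_mk _
      source' := by ext; simp [xv, hpE]
      target' := by ext; simp [xv, hpE] }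
  have hG : ∀ k u, (G k u : E) = AffineMap.lineMap (xv k.castSucc) (xv k.succ) (u : ℝ) :=
    fun k u => rfl
  -- each arc is homotopic to its chord
  have hFG : ∀ k : Fin N, (p.subpath (t k.castSucc) (t k.succ)).Homotopic (G k) := fun k =>
    ⟨linearHomotopy _ _ fun s u => by
      show (1 - (s : ℝ)) • (p (conv k u) : E) +
        (s : ℝ) • AffineMap.lineMap (xv k.castSucc) (xv k.succ) (u : ℝ) ∈ A
      exact hmemA k s u⟩
  have H1 : (Path.concat (p ∘ t) fun k => p.subpath (t k.castSucc) (t k.succ)).Homotopic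
      (p.subpath (t 0) (t (Fin.last N))) := Path.Homotopic.concat_subpath p t
  have H2 : (Path.concat (p ∘ t) fun k => p.subpath (t k.castSucc) (t k.succ)).Homotopic
      (Path.concat (p ∘ t) G) :=
    Path.Homotopic.concat_hcomp (⇑p ∘ t) (fun k => p.subpath (t k.castSucc) (t k.succ)) G hFG
  have H3 : (p.subpath (t 0) (t (Fin.last N))).Homotopic (Path.concat (p ∘ t) G) :=
    H1.symm.trans H2
  -- back to the base point `x`
  have e0 : x = p (t 0) := by
    have : t 0 = 0 := Subtype.ext ht0
    rw [this, p.source]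
  have e1 : x = p (t (Fin.last N)) := by
    have : t (Fin.last N) = 1 := Subtype.ext ht1
    rw [this, p.target]
  have hcast : (p.subpath (t 0) (t (Fin.last N))).cast e0 e1 = p := by
    ext u
    show ((p.subpath (t 0) (t (Fin.last N))) u : E) = p u
    show (p (Icc.convexComb (t 0) (t (Fin.last N)) u) : E) = p u
    congr 2
    ext
    show (1 - (u : ℝ)) * ((t 0 : I) : ℝ) + (u : ℝ) * ((t (Fin.last N) : I) : ℝ) = u
    rw [ht0, ht1]; ring
  set L : Path x x := (Path.concat (p ∘ t) G).cast e0 e1 with hLdef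
  have H4 : p.Homotopic L := by
    have := H3.pathCast e0 e1
    rwa [hcast] at this
  ----------------------------------------------------------------------------------------------
  -- Step 3: the polygon is contracted inside the set visible from a generic apex
  ----------------------------------------------------------------------------------------------
  obtain ⟨z, hzC, hzT, hzcone⟩ := exists_apex hdim h W hW hh hT
    (fun k : Fin N => xv k.castSucc) (fun k => xv k.succ) hCo hCne
  set Z : Set E := visibleSet z A with hZdef
  have hZsc : IsSimplyConnected Z := isSimplyConnected_visibleSet ⟨hzC, hzT⟩
  have hZA : Z ⊆ A := visibleSet_subset z A
  have hsegZ : ∀ k : Fin N, segment ℝ (xv k.castSucc) (xv k.succ) ⊆ Z := fun k =>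
    segment_subset_visibleSet hC hzC (hzcone k) fun y hy => by
      obtain ⟨l, hl, rfl⟩ := exists_lineMap_of_mem_segment hy
      exact hsegA k ⟨l, hl⟩
  have hLZ : ∀ u, (L u : E) ∈ Z := by
    intro u
    show ((Path.concat (p ∘ t) G) u : E) ∈ Z
    refine concat_mem (S := {w : A | (w : E) ∈ Z}) (p ∘ t) G ?_ (fun k v => ?_) u
    · show (p (t 0) : E) ∈ Z
      have : (p (t 0) : E) = xv (0 : Fin N).castSucc := by simp [xv, hpE]
      rw [this]
      exact hsegZ 0 (left_mem_segment ℝ _ _)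
    · show (G k v : E) ∈ Z
      rw [hG]
      exact hsegZ k (lineMap_mem_segment ℝ _ _ ⟨v.2.1, v.2.2⟩)
  -- contract `L` inside `Z`, and read the contraction in `A`
  obtain ⟨FZ, hFZ⟩ := (isSimplyConnected_iff_exists_homotopy_refl_forall_mem.1 hZsc).2 (x : E)
    (L.map continuous_subtype_val) hLZ
  have H5 : L.Homotopic (Path.refl x) :=
    ⟨{ toFun := fun q => ⟨FZ q, hZA (hFZ q)⟩
       continuous_toFun := FZ.continuous.subtype_mk _
       map_zero_left := fun u => by ext; show FZ (0, u) = (L u : E); rw [FZ.apply_zero]; rfl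
       map_one_left := fun u => by ext; show FZ (1, u) = (x : E); rw [FZ.apply_one]; rfl
       prop' := fun s u hu => by
         ext
         show FZ (s, u) = (L u : E)
         exact FZ.prop' s u hu }⟩
  exact H4.trans H5

end SmallSet

end Literature.Topology.FourManifolds
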